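import Summits.BirchSwinnertonDyer.BirchSwinnertonDyer.Theorems.AlignedTransportAtTwoMainConjectureOfRankZeroBSDAtTwoTorsionPointField
import Literature.NumberTheory.EllipticCurves.IwasawaModuleFinitePadicIntProofs
import HarnessLib

/-!
# Doors at `p = 2` on the `2`-torsion point field `ℚ(P)`: Coates–Sujatha's statement (A) at `(E, 2)` from
# Lim 2017 Thm. 3.5 at `2` and the classical `μ = 0` of `ℚ(P)` (numerically: Fukuda 1994 / Iwasawa 1956)

HONEST FRAMING (cell `bsd-f1-sign2`; WIDTH-5 attached prover seat `bsd-line-att-p5` gen 2 on route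
`AlignedTransportAtTwo`, crux C2 `MainConjectureOfRankZeroBSDAtTwo` (stmt-BirchSwinnertonDyer-22298), line `birth`,
stub A₂ of ROAD (b); `--supports` 22298; closes nothing; BSD is proved for no curve here).  THEOREMS ONLY;
ROUTE-INDEPENDENT.  Continuation of `…MainConjectureOfRankZeroBSDAtTwoTorsionPointField` (§1–§2: for a non-zero
`P ∈ E[2]` the torsion-point field `K(P) = K̄^{Stab(P)}` lies below `K(E[4])` with `[K(E[4]) : K(P)] = 2^k` —
Lim's index hypothesis at `p = 2`, discharged structurally).  Here, §3: the DOORS this opens for `E/ℚ`, BY NAME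
and conditional on the named facts only —

* `fineSelmerDual_moduleFinite_two_of_classicalMu_pointField` / `finite_fineSelmer_twoTorsion_of_classicalMu_pointField`:
  statement (A) at `(E, 2)` (`∃ γ D` form / intrinsic form «`Sel₀(ℚ_∞, E[2^∞])[2]` finite», the hypothesis `hA`
  of the lead's `AlignedTransportAtTwoFineRoad.mazurMainConjecture_two_of_bsdp_of_fineRoad`) from Lim 2017 Thm. 3.5
  at `2` (tree fact) + `ClassicalMuVanishes` for the cyclotomic `ℤ₂`-extension(s) of `ℚ(P)` — NO displayed
  subfield, NO displayed index;
* `…_of_classNumberPExp_succ_eq_pointField`, `…_of_classGroupPRank_succ_eq_pointField` (Fukuda 1994 Thm. 1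
  (1)/(2)): the same from two consecutive layers `n, n+1 ≥ n₀` of the tower `ℚ(P) ⊂ ℚ(P,√2) ⊂ ℚ(P)·ℚ(ζ₁₆)⁺ ⊂ …`
  with equal `ord₂ h` resp. equal `2`-rank — the certificates of the cell's data ask D-att-p2-1 plug in here;
* `…_of_not_dvd_classNumber_pointField` (Iwasawa 1956): from `2 ∤ h(ℚ(P))` and ONE prime of `ℚ(P)` above `2`
  (not the good-ordinary case, where the `2`-division cubic has a `2`-adic root);
* `finite_fineSelmer_twoTorsion_of_abelian_pointField`: UNCONDITIONALLY modulo print (Lim + Ferrero–Washington)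
  when `ℚ(P)/ℚ` is abelian (rational `2`-torsion; cyclic cubic `2`-division field) — the lead's
  `finite_fineSelmer_twoTorsion_of_abelian_subfield` with subfield and index supplied.

On the route's cell `ℚ(P)` is an `S₃`-cubic and `μ₂(ℚ(P)) = 0` class-wide is Iwasawa's conjecture (OPEN); per
seed it is a finite class-group computation (two layers of degrees `3·2ⁿ`, `3·2ⁿ⁺¹`).

References: [Lim2017FineSelmer] §3 Thm. 3.5, Lemma 3.2; [CoatesSujatha2005] §3; [Fukuda1994] Thm. 1;
[Greenberg2001IwasawaPastPresent] Prop. 2.1; [Lang1990] Ch. 10 §3 Thm. 3.4; [LimSujatha2018] §3.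
-/

noncomputable section

open scoped Classical

universe u

namespace Summit.BirchSwinnertonDyer.BirchSwinnertonDyer.Theorems.AlignedTransportAtTwoTorsionPointField

open WeierstrassCurve Field Literature.NumberTheory.EllipticCurves Literature.NumberTheory.GaloisRepresentations

/-! ## §3 Doors at `p = 2` for `E/ℚ` on the `2`-torsion point field `ℚ(P)`: statement (A) at `(E, 2)` from
Lim 2017 Thm. 3.5 at `2` and Iwasawa's classical `μ = 0` of `ℚ(P)` (numerically: Fukuda 1994 / Iwasawa 1956) -/

section Doors

open Literature.NumberTheory.IwasawaTheory IsDedekindDomain NumberField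
  Literature.NumberTheory.EllipticCurves.IwasawaModuleFinitePadicInt

/-- **Statement (A) at `(E, 2)` from the classical `μ = 0` of ONE `2`-torsion point field** (`∃ γ D` form of
the tree's fine-Selmer facts).  Granted Lim 2017 Thm. 3.5 at `p = 2` (named fact `hLim`, PRINT): for `E/ℚ`
elliptic and a non-zero `P ∈ E[2]`, if every cyclotomic `ℤ₂`-extension of `ℚ(P) = ℚ̄^{Stab(P)}` has Iwasawa
`μ = 0` in growth form (`ClassicalMuVanishes`), then the dual fine Selmer group of `E` over `ℚ^{cyc}` is
finitely generated over `ℤ₂`.  Lim's hypotheses `ℚ(P) ⊆ ℚ(E[4])`, `[ℚ(E[4]) : ℚ(P)] = 2^k` are DISCHARGED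
(§2); for `E[2]` irreducible `ℚ(P)` is the cubic field of a root of the `2`-division cubic, for a rational
`P` it is `ℚ` (then Ferrero–Washington applies).  CONDITIONAL on `hLim` only.
[cite: Lim2017FineSelmer, §3 Thm. 3.5 and Lemma 3.2 (arXiv:1306.2047 pp. 6–7)] [cite: CoatesSujatha2005, statement (A) and Thm. 3.4] -/
theorem fineSelmerDual_moduleFinite_two_of_classicalMu_pointField
    (hLim : Lim2017.thm35_at_two_fineSelmerDual_moduleFinite_of_classicalMuVanishes_of_le_divisionField_four)
    (W : WeierstrassCurve ℚ) [W.IsElliptic] {P : geomTorsion W 2} (hP : P ≠ 0)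
    (hμ : ∀ κL : ZpExtension
        (IntermediateField.fixedField (MulAction.stabilizer (absoluteGaloisGroup ℚ) P)) 2,
      κL.IsCyclotomic → ClassicalMuVanishes κL)
    (κ : ZpExtension ℚ 2) (hκ : κ.IsCyclotomic) :
    ∃ (γ : absoluteGaloisGroup ℚ) (D : W.FineSelmerDualData κ γ),
      Module.Finite ℤ_[2] (RestrictScalars ℤ_[2] (IwasawaAlgebra 2) D.X) :=
  hLim W _ (fixedField_stabilizer_le_divisionField_four W P)
    (exists_finrank_divisionField_four_eq_pow_mul_finrank_fixedField_stabilizer W hP) hμ κ hκ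

/-- **Statement (A) at `(E, 2)`, intrinsic form — `Sel₀(ℚ_∞, E[2^∞])[2]` finite — from the classical `μ = 0`
of ONE `2`-torsion point field `ℚ(P)`** (Lim 2017 at `2`, `hLim`; the `∃ γ D` form made intrinsic by the
tree's `finite_pTorsion_of_fineSelmerDualData_moduleFinite`).  This is the hypothesis `hA` of the fine-road
doors of `…MainConjectureOfRankZeroBSDAtTwoFineRoadCrux` (`mazurMainConjecture_two_of_bsdp_of_fineRoad`).
CONDITIONAL on `hLim` only. [cite: Lim2017FineSelmer, §3 Thm. 3.5 and Lemma 3.2] [cite: LimSujatha2018, §3 (before Prop. 3.2)] -/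
theorem finite_fineSelmer_twoTorsion_of_classicalMu_pointField
    (hLim : Lim2017.thm35_at_two_fineSelmerDual_moduleFinite_of_classicalMuVanishes_of_le_divisionField_four)
    (W : WeierstrassCurve ℚ) [W.IsElliptic] {P : geomTorsion W 2} (hP : P ≠ 0)
    (hμ : ∀ κL : ZpExtension
        (IntermediateField.fixedField (MulAction.stabilizer (absoluteGaloisGroup ℚ) P)) 2,
      κL.IsCyclotomic → ClassicalMuVanishes κL)
    (κ : ZpExtension ℚ 2) (hκ : κ.IsCyclotomic) :
    Set.Finite {s : W.fineSelmerInfty κ | 2 • s = 0} := by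
  obtain ⟨γ, D, hD⟩ := fineSelmerDual_moduleFinite_two_of_classicalMu_pointField hLim W hP hμ κ hκ
  exact finite_pTorsion_of_fineSelmerDualData_moduleFinite W κ D hD

/-- **Door (Fukuda 1994 Thm. 1 (1) ∘ Lim 2017 at `2`) on `ℚ(P)`, by name.**  Granted the two named facts: if,
for a non-zero `P ∈ E[2]`, every cyclotomic `ℤ₂`-extension `κ_L` of `ℚ(P)` has Fukuda's index `n₀`
(`TotallyRamifiedFrom κ_L n₀`: the primes above `2` are totally ramified in `ℚ(P)_∞/ℚ(P)_{n₀}`) and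
`ord₂ h(ℚ(P)_{n+1}) = ord₂ h(ℚ(P)_n)` for ONE `n ≥ n₀`, then `Sel₀(ℚ_∞, E[2^∞])[2]` is finite.  The displayed
hypotheses are NUMERIC (two class numbers of the layers `ℚ(P)`, `ℚ(P, √2)`, `ℚ(P)·ℚ(ζ₁₆)⁺, …`); CONDITIONAL on
the facts; (A) is asserted for no curve here. [cite: Fukuda1994, Thm. 1 (1), p. 264]
[cite: Lim2017FineSelmer, §3 Thm. 3.5 and Lemma 3.2] -/
theorem finite_fineSelmer_twoTorsion_of_classNumberPExp_succ_eq_pointField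
    (hF1 : fukuda1994_thm1_classNumberPExp_const_of_succ_eq)
    (hLim : Lim2017.thm35_at_two_fineSelmerDual_moduleFinite_of_classicalMuVanishes_of_le_divisionField_four)
    (W : WeierstrassCurve ℚ) [W.IsElliptic] {P : geomTorsion W 2} (hP : P ≠ 0) {n₀ n : ℕ} (hn : n₀ ≤ n)
    (hram : ∀ κL : ZpExtension
        (IntermediateField.fixedField (MulAction.stabilizer (absoluteGaloisGroup ℚ) P)) 2,
      κL.IsCyclotomic → TotallyRamifiedFrom κL n₀)
    (hord : ∀ κL : ZpExtension
        (IntermediateField.fixedField (MulAction.stabilizer (absoluteGaloisGroup ℚ) P)) 2,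
      κL.IsCyclotomic → classNumberPExp κL (n + 1) = classNumberPExp κL n)
    (κ : ZpExtension ℚ 2) (hκ : κ.IsCyclotomic) :
    Set.Finite {s : W.fineSelmerInfty κ | 2 • s = 0} := by
  haveI := finiteDimensional_fixedField_stabilizer W P
  haveI : NumberField (IntermediateField.fixedField (MulAction.stabilizer (absoluteGaloisGroup ℚ) P)) :=
    NumberField.mk
  exact finite_fineSelmer_twoTorsion_of_classicalMu_pointField hLim W hP
    (fun κL hκL => classicalMuVanishes_of_classNumberPExp_succ_eq hF1 κL (hram κL hκL) hn (hord κL hκL))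
    κ hκ

/-- **Door (Fukuda 1994 Thm. 1 (2) ∘ Lim 2017 at `2`) on `ℚ(P)`, by name** — as the previous door with the
`2`-RANK certificate `rank₂ Cl(ℚ(P)_{n+1}) = rank₂ Cl(ℚ(P)_n)` (`classGroupPRank`).  CONDITIONAL on the two
facts; (A) asserted for no curve. [cite: Fukuda1994, Thm. 1 (2), p. 264] [cite: Lim2017FineSelmer, §3 Thm. 3.5 and Lemma 3.2] -/
theorem finite_fineSelmer_twoTorsion_of_classGroupPRank_succ_eq_pointField
    (hF2 : fukuda1994_thm1_classGroupPRank_const_of_succ_eq)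
    (hLim : Lim2017.thm35_at_two_fineSelmerDual_moduleFinite_of_classicalMuVanishes_of_le_divisionField_four)
    (W : WeierstrassCurve ℚ) [W.IsElliptic] {P : geomTorsion W 2} (hP : P ≠ 0) {n₀ n : ℕ} (hn : n₀ ≤ n)
    (hram : ∀ κL : ZpExtension
        (IntermediateField.fixedField (MulAction.stabilizer (absoluteGaloisGroup ℚ) P)) 2,
      κL.IsCyclotomic → TotallyRamifiedFrom κL n₀)
    (hrk : ∀ κL : ZpExtension
        (IntermediateField.fixedField (MulAction.stabilizer (absoluteGaloisGroup ℚ) P)) 2,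
      κL.IsCyclotomic → classGroupPRank κL (n + 1) = classGroupPRank κL n)
    (κ : ZpExtension ℚ 2) (hκ : κ.IsCyclotomic) :
    Set.Finite {s : W.fineSelmerInfty κ | 2 • s = 0} := by
  haveI := finiteDimensional_fixedField_stabilizer W P
  haveI : NumberField (IntermediateField.fixedField (MulAction.stabilizer (absoluteGaloisGroup ℚ) P)) :=
    NumberField.mk
  exact finite_fineSelmer_twoTorsion_of_classicalMu_pointField hLim W hP
    (fun κL hκL => classicalMuVanishes_of_classGroupPRank_succ_eq hF2 κL (hram κL hκL) hn (hrk κL hκL))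
    κ hκ

/-- **Door (Iwasawa 1956 ∘ Lim 2017 at `2`) on `ℚ(P)`, by name**: if `2 ∤ h(ℚ(P))` and EXACTLY ONE prime of
`ℚ(P)` lies above `2` (e.g. the `2`-division cubic irreducible over `ℚ₂` — supersingular or suitable additive
reduction at `2`; NOT the good-ordinary case, where the cubic has a `2`-adic root), then `Sel₀(ℚ_∞, E[2^∞])[2]`
is finite.  CONDITIONAL on the two facts. [cite: Greenberg2001IwasawaPastPresent, Prop. 2.1 p. 339]
[cite: Lim2017FineSelmer, §3 Thm. 3.5 and Lemma 3.2] -/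
theorem finite_fineSelmer_twoTorsion_of_not_dvd_classNumber_pointField
    (hIw : iwasawa1956_classNumberPExp_eq_zero_of_not_dvd_classNumber_of_unique_prime)
    (hLim : Lim2017.thm35_at_two_fineSelmerDual_moduleFinite_of_classicalMuVanishes_of_le_divisionField_four)
    (W : WeierstrassCurve ℚ) [W.IsElliptic] {P : geomTorsion W 2} (hP : P ≠ 0)
    (hh : ¬ 2 ∣ Nat.card (ClassGroup
      (𝓞 (IntermediateField.fixedField (MulAction.stabilizer (absoluteGaloisGroup ℚ) P)))))
    (hv : ∃! v : HeightOneSpectrum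
        (𝓞 (IntermediateField.fixedField (MulAction.stabilizer (absoluteGaloisGroup ℚ) P))),
      ((2 : ℕ) : 𝓞 (IntermediateField.fixedField (MulAction.stabilizer (absoluteGaloisGroup ℚ) P))) ∈
        v.asIdeal)
    (κ : ZpExtension ℚ 2) (hκ : κ.IsCyclotomic) :
    Set.Finite {s : W.fineSelmerInfty κ | 2 • s = 0} := by
  haveI := finiteDimensional_fixedField_stabilizer W P
  haveI : NumberField (IntermediateField.fixedField (MulAction.stabilizer (absoluteGaloisGroup ℚ) P)) :=
    NumberField.mk
  have hh' : ¬ 2 ∣ NumberField.classNumber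
      (IntermediateField.fixedField (MulAction.stabilizer (absoluteGaloisGroup ℚ) P)) := by
    rwa [NumberField.classNumber, ← Nat.card_eq_fintype_card]
  exact finite_fineSelmer_twoTorsion_of_classicalMu_pointField hLim W hP
    (fun κL _ => classicalMuVanishes_of_classNumberPExp_eq_zero hIw hh' hv κL) κ hκ

/-- **Statement (A) at `(E, 2)` when ONE `2`-torsion point field `ℚ(P)` is ABELIAN over `ℚ`, modulo two
printed facts** (Lim 2017 at `2` + Ferrero–Washington): e.g. a RATIONAL point of order `2` (`ℚ(P) = ℚ`) or a
CYCLIC cubic `2`-division field (mod-`2` image `C₃`, `ℚ(P) = ℚ(E[2])` Galois with group `C₃`).  This is the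
lead's `AlignedTransportAtTwoFineRoad.finite_fineSelmer_twoTorsion_of_abelian_subfield` with the subfield AND its
`2`-power index now SUPPLIED (§2) — only abelianness of `ℚ(P)` is displayed.  Off the route's cell (there
`ℚ(P)` is an `S₃`-cubic, for which Iwasawa's `μ = 0` is open). [cite: Lim2017FineSelmer, §3 Thm. 3.5 and Lemma 3.2]
[cite: Lang1990, Ch. 10 §3 Thm. 3.4 (pp. 258–261)] -/
theorem finite_fineSelmer_twoTorsion_of_abelian_pointField
    (hLim : Lim2017.thm35_at_two_fineSelmerDual_moduleFinite_of_classicalMuVanishes_of_le_divisionField_four)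
    (hFW : ferreroWashington1979_classicalMuVanishes)
    (W : WeierstrassCurve ℚ) [W.IsElliptic] {P : geomTorsion W 2} (hP : P ≠ 0)
    [IsAbelianGalois ℚ (IntermediateField.fixedField (MulAction.stabilizer (absoluteGaloisGroup ℚ) P))]
    (κ : ZpExtension ℚ 2) (hκ : κ.IsCyclotomic) :
    Set.Finite {s : W.fineSelmerInfty κ | 2 • s = 0} := by
  haveI := finiteDimensional_fixedField_stabilizer W P
  haveI : NumberField (IntermediateField.fixedField (MulAction.stabilizer (absoluteGaloisGroup ℚ) P)) :=
    NumberField.mk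
  exact finite_fineSelmer_twoTorsion_of_classicalMu_pointField hLim W hP (fun κL hκL => hFW _ 2 κL hκL) κ hκ

/-! ## APPEND (same seat, same session): the `∃ L ⊆ ℚ(E[4])`-clause of Lim's road at `p = 2`, for ANY curve,
from the `μ` of one `2`-torsion point field — the cell-free form of `…TorsionPointFieldCrux`'s
`classicalMuSeedFields_of_pointFieldMu` (serves every consumer that displays the clause: stub A₂ of line `birth`,
`CubicDoor` of crux `SignedMuSeedAtTwoPlus` (stmt-BirchSwinnertonDyer-21438), the additive-at-`2` Kato-fine files
with displayed `(L, hL, hdeg)`) -/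

/-- **The class-group clause of Lim's road at `p = 2` from ONE `2`-torsion point field, for any elliptic
`E/ℚ`**: if some non-zero `P ∈ E[2]` has Iwasawa `μ = 0` (growth form) for every cyclotomic `ℤ₂`-extension of
`ℚ(P) = ℚ̄^{Stab(P)}`, then there IS a subfield `L ⊆ ℚ(E[4])` of `2`-power index all of whose cyclotomic
`ℤ₂`-extensions have `μ = 0` — namely `L = ℚ(P)` (§2 of `…TorsionPointField`).  No hypothesis on `E` beyond
ellipticity; the `∃ L` shape is verbatim the one displayed by the tree's consumers of
`Lim2017.thm35_at_two_fineSelmerDual_moduleFinite_of_classicalMuVanishes_of_le_divisionField_four`.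
[cite: Lim2017FineSelmer, §3 Thm. 3.5 (hypothesis on L)] [cite: Serre1972, §IV] -/
theorem exists_le_divisionField_four_of_pointFieldMu (W : WeierstrassCurve ℚ) [W.IsElliptic]
    {P : geomTorsion W 2} (hP : P ≠ 0)
    (hμ : ∀ κL : ZpExtension
        (IntermediateField.fixedField (MulAction.stabilizer (absoluteGaloisGroup ℚ) P)) 2,
      κL.IsCyclotomic → ClassicalMuVanishes κL) :
    ∃ L : IntermediateField ℚ (AlgebraicClosure ℚ), L ≤ W.divisionField 4 ∧
      (∃ k : ℕ, Module.finrank ℚ (W.divisionField 4) = 2 ^ k * Module.finrank ℚ L) ∧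
      ∀ κL : ZpExtension L 2, κL.IsCyclotomic → ClassicalMuVanishes κL :=
  ⟨_, fixedField_stabilizer_le_divisionField_four W P,
    exists_finrank_divisionField_four_eq_pow_mul_finrank_fixedField_stabilizer W hP, hμ⟩

/-- **The same clause from Fukuda's class-number certificate on `ℚ(P)`** (Fukuda 1994 Thm. 1 (1), named fact
`hF1`): two consecutive layers `n, n+1 ≥ n₀` of the cyclotomic `ℤ₂`-tower of `ℚ(P)` with equal `ord₂ h` give the
`∃ L` clause — the per-curve CERTIFICATE form consumed by `CubicDoor`-shaped stubs.  CONDITIONAL on `hF1`.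
[cite: Fukuda1994, Thm. 1 (1), p. 264] [cite: Lim2017FineSelmer, §3 Thm. 3.5 (hypothesis on L)] -/
theorem exists_le_divisionField_four_of_classNumberPExp_succ_eq_pointField
    (hF1 : fukuda1994_thm1_classNumberPExp_const_of_succ_eq)
    (W : WeierstrassCurve ℚ) [W.IsElliptic] {P : geomTorsion W 2} (hP : P ≠ 0) {n₀ n : ℕ} (hn : n₀ ≤ n)
    (hram : ∀ κL : ZpExtension
        (IntermediateField.fixedField (MulAction.stabilizer (absoluteGaloisGroup ℚ) P)) 2,
      κL.IsCyclotomic → TotallyRamifiedFrom κL n₀)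
    (hord : ∀ κL : ZpExtension
        (IntermediateField.fixedField (MulAction.stabilizer (absoluteGaloisGroup ℚ) P)) 2,
      κL.IsCyclotomic → classNumberPExp κL (n + 1) = classNumberPExp κL n) :
    ∃ L : IntermediateField ℚ (AlgebraicClosure ℚ), L ≤ W.divisionField 4 ∧
      (∃ k : ℕ, Module.finrank ℚ (W.divisionField 4) = 2 ^ k * Module.finrank ℚ L) ∧
      ∀ κL : ZpExtension L 2, κL.IsCyclotomic → ClassicalMuVanishes κL := by
  haveI := finiteDimensional_fixedField_stabilizer W P
  haveI : NumberField (IntermediateField.fixedField (MulAction.stabilizer (absoluteGaloisGroup ℚ) P)) :=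
    NumberField.mk
  exact exists_le_divisionField_four_of_pointFieldMu W hP
    (fun κL hκL => classicalMuVanishes_of_classNumberPExp_succ_eq hF1 κL (hram κL hκL) hn (hord κL hκL))

end Doors

end Summit.BirchSwinnertonDyer.BirchSwinnertonDyer.Theorems.AlignedTransportAtTwoTorsionPointField

end
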